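import Summits.ResolutionOfSingularities.ResolutionOfSingularities.Theorems.SandwichedSingularitiesResolution
import Summits.ResolutionOfSingularities.ResolutionOfSingularities.Theorems.ValuativePatchingRelBlowupExtension
import Literature.AlgebraicGeometry.Resolution.ProperModelsRegLeification
import Literature.AlgebraicGeometry.Resolution.LocalRegLeificationOfSandwiched
import Literature.AlgebraicGeometry.Resolution.AlterationsDimension
import Literature.AlgebraicGeometry.Resolution.SandwichedWeakPatching
import HarnessLib

/-!
# Crux `PatchingRel` (stmt-ResolutionOfSingularities-0642), line `sandwiched-gluing` (v3 cut):
# the Nagata-free bridge SANDᵇ ⇒ SANDᴸ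

For an integral separated scheme of finite type `M` over a field `k` of characteristic `p`,
opens `V ⊆ O ⊆ M` with every point of `O ∖ V` regular, and a proper birational `k`-morphism
`η : V → U` onto a regular variety `U`, the v3 atom SANDᵇ(p) (`SandwichedBlowupResolution p`:
varieties with sandwiched singular locus are desingularised by ONE blowing up) applied to the
open subscheme `O` gives a non-zero ideal sheaf `I` on `O` whose blowing up is regular
(`exists_isBlowup_opens_of_sandwichedBlowup`). A blowing up of an open extends: the blowing up
of `M` along the push-forward ideal `I.map O.ι` is proper and birational with integral source
and restricts over `O` to `Bl_I O` (`exists_isPullback_of_isBlowup_opens`, stub B0, landed), so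
it is regular over `O` (`exists_regular_over_of_isBlowup_opens`). Hence

* `sandwichedLocusResolution_of_sandwichedBlowup` — **SANDᵇ(p) ⇒ SANDᴸ(p)** with no
  compactification theorem and no gluing (registered stub `stub_sandwichedLocus_of_sandwichedBlowup`),
  and therefore SANDᵇ(p) ⇒ SANDʷ(p);
* `sandwichedLocusResolutionDimGt_of_sandwichedBlowupDimGt` — the same slice by slice in the
  dimension (`dim O = dim M` for a non-empty open of a variety, Görtz–Wedhorn I, Thm. 5.22 (3)),
  registered stub `stub_sandwichedLocusDimGt_of_sandwichedBlowupDimGt`.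

Compare the gen-1 bridge `sandwichedLocusResolution_of_nagata_of_sandwichedWeak`
(`Theorems/ValuativePatchingRelSandwichedBridges.lean`), where the extension of an abstract
resolution `N₀ → O` over `M` costs Nagata compactification: here the FORMAT of the resolution
(a blowing up) pays for it — Piltant 2013, proof of Prop. 5.1, Step 2 ("blow up the Zariski
closure of the centre"), applied to a whole resolution.

## References

* O. Piltant, *An axiomatic version of Zariski's patching theorem*, RACSAM 107 (2013) 91–121,
  Prop. 5.1 (proof, Step 2). [Piltant2013]
* U. Görtz, T. Wedhorn, *Algebraic Geometry I*, 2nd ed. (2020), Prop. 13.91 (2), Thm. 5.22 (3).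
  [GortzWedhorn2020]
-/

-- `Summit.<Summit>.<Sub>.Theorems` with `Sub = Summit` (single-conjunct summit, D-0017): the
-- duplicated namespace component is the tree layout.
set_option linter.dupNamespace false

noncomputable section

namespace Summit.ResolutionOfSingularities.ResolutionOfSingularities.Theorems

open CategoryTheory AlgebraicGeometry TopologicalSpace
open Literature.AlgebraicGeometry.Resolution

universe u

/-- **A blowing-up resolution of an open extends to a modification regular over it**: for an
integral locally Noetherian scheme `M`, an open `O ⊆ M`, and a blowing up `π : N₀ → O` along a
non-zero ideal sheaf with `N₀` regular, there is a proper birational `ρ : N → M` with integral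
source such that every point of `N` over `O` is regular (the blowing up of `M` along the
push-forward ideal, `exists_isPullback_of_isBlowup_opens`; regularity transfers along the
cartesian square, `isRegularLocalRing_stalk_of_isPullback_ι`).
[cite: Piltant2013, Prop. 5.1 (proof, Step 2)] -/
theorem exists_regular_over_of_isBlowup_opens {M : Scheme.{u}} [IsIntegral M]
    [IsLocallyNoetherian M] (O : M.Opens) {N₀ : Scheme.{u}} {π : N₀ ⟶ (O : Scheme.{u})}
    {I : (O : Scheme.{u}).IdealSheafData} (hI : I ≠ ⊥) (hπ : IsBlowup π I)
    (hreg : Scheme.IsRegular N₀) :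
    ∃ (N : Scheme.{u}) (ρ : N ⟶ M), IsIntegral N ∧ IsProper ρ ∧ IsBirational ρ ∧
      ∀ n : N, ρ n ∈ O → IsRegularLocalRing (N.presheaf.stalk n) := by
  obtain ⟨Z, ρ, s, hZ, hρ, hbir, hs, hsq, -⟩ := exists_isPullback_of_isBlowup_opens O hI hπ
  haveI := hs
  refine ⟨Z, ρ, hZ, hρ, hbir, fun n hn => ?_⟩
  exact isRegularLocalRing_stalk_of_isPullback_ι hsq (S := (O : Set M)) le_rfl
    (fun m _ => hreg m) n hn

/-- **The open subscheme `O` carries the datum of SANDᵇ/SANDʷ** (plumbing shared by the bridge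
and its dimension slice): for an integral separated finite-type `M` over `k`, opens `V ⊆ O ⊆ M`
with `O ∖ V` regular and `η : V → U` proper birational onto a regular variety, the scheme `O`
is an integral separated `k`-scheme of finite type, regular off its open `V' := O ∩ V`, and
`V' ≅ V → U` is proper birational and compatible with the structure maps. Stated as: every
predicate on such data which SANDᵇ-type statements conclude holds for `O`. [folklore] -/
theorem sandwichedDatum_opens {p : ℕ} {k : Type u} [Field k] [CharP k p] {U M : Scheme.{u}}
    (f : U ⟶ Spec (.of k)) (g : M ⟶ Spec (.of k)) [IsSeparated f] [LocallyOfFiniteType f]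
    [QuasiCompact f] [IsIntegral U] (hU : Scheme.IsRegular U) [IsSeparated g]
    [LocallyOfFiniteType g] [QuasiCompact g] [IsIntegral M] (O V : M.Opens)
    (η : (V : Scheme.{u}) ⟶ U) [IsProper η] (hbir : IsBirational η) (hcompat : η ≫ f = V.ι ≫ g)
    (hVO : V ≤ O) (hout : ∀ x : M, x ∈ O → x ∉ V → IsRegularLocalRing (M.presheaf.stalk x))
    [Nonempty (O : Scheme.{u})] {P : Scheme.{u} → Prop}
    (hS : ∀ (U X : Scheme.{u}) (f : U ⟶ Spec (.of k)) (g : X ⟶ Spec (.of k)) (V : X.Opens)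
      (η : (V : Scheme.{u}) ⟶ U), IsSeparated f → LocallyOfFiniteType f → QuasiCompact f →
      IsIntegral U → Scheme.IsRegular U → IsSeparated g → LocallyOfFiniteType g →
      QuasiCompact g → IsIntegral X → IsProper η → IsBirational η → η ≫ f = V.ι ≫ g →
      (∀ x : X, x ∉ V → IsRegularLocalRing (X.presheaf.stalk x)) → P X) :
    P (O : Scheme.{u}) := by
  haveI : IsIntegral (O : Scheme.{u}) := isIntegral_of_isOpenImmersion O.ι
  haveI : IsLocallyNoetherian M := LocallyOfFiniteType.isLocallyNoetherian g
  -- the sandwiched piece of `O`: `V' := O ∩ V ≅ V`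
  let V' : (O : Scheme.{u}).Opens := O.ι ⁻¹ᵁ V
  let e : (V' : Scheme.{u}) ≅ (V : Scheme.{u}) := Scheme.Opens.isoOfLE hVO
  let η' : (V' : Scheme.{u}) ⟶ U := e.hom ≫ η
  have hη'proper : IsProper η' := inferInstance
  have hη'bir : IsBirational η' := (isBirational_of_isIso e.hom).comp hbir
  have hη'compat : η' ≫ f = V'.ι ≫ (O.ι ≫ g) := by
    simp only [η', Category.assoc]
    rw [hcompat, ← Category.assoc, Scheme.Opens.isoOfLE_hom_ι, Category.assoc]
  have hout' : ∀ x : (O : Scheme.{u}), x ∉ V' →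
      IsRegularLocalRing ((O : Scheme.{u}).presheaf.stalk x) := fun x hx =>
    (isRegularLocalRing_stalk_iff_of_isOpenImmersion O.ι x).mp (hout x.1 x.2 hx)
  exact hS U (O : Scheme.{u}) f (O.ι ≫ g) V' η' inferInstance inferInstance inferInstance
    inferInstance hU inferInstance inferInstance inferInstance inferInstance hη'proper hη'bir
    hη'compat hout'

/-- **SANDᵇ(p) desingularises a sandwiched-singularity open by a blowing up**: in the situation
of SANDᴸ(p) with `O` non-empty, SANDᵇ(p) applied to the scheme `O` gives a non-zero ideal sheaf
on `O` whose blowing up is regular. [folklore] -/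
theorem exists_isBlowup_opens_of_sandwichedBlowup {p : ℕ} (hS : SandwichedBlowupResolution.{u} p)
    {k : Type u} [Field k] [CharP k p] {U M : Scheme.{u}} (f : U ⟶ Spec (.of k))
    (g : M ⟶ Spec (.of k)) [IsSeparated f] [LocallyOfFiniteType f] [QuasiCompact f]
    [IsIntegral U] (hU : Scheme.IsRegular U) [IsSeparated g] [LocallyOfFiniteType g]
    [QuasiCompact g] [IsIntegral M] (O V : M.Opens) (η : (V : Scheme.{u}) ⟶ U) [IsProper η]
    (hbir : IsBirational η) (hcompat : η ≫ f = V.ι ≫ g) (hVO : V ≤ O)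
    (hout : ∀ x : M, x ∈ O → x ∉ V → IsRegularLocalRing (M.presheaf.stalk x))
    [Nonempty (O : Scheme.{u})] :
    ∃ (I : (O : Scheme.{u}).IdealSheafData) (N₀ : Scheme.{u}) (π : N₀ ⟶ (O : Scheme.{u})),
      I ≠ ⊥ ∧ IsBlowup π I ∧ Scheme.IsRegular N₀ :=
  sandwichedDatum_opens f g hU O V η hbir hcompat hVO hout
    (P := fun X => ∃ (I : X.IdealSheafData) (N₀ : Scheme.{u}) (π : N₀ ⟶ X),
      I ≠ ⊥ ∧ IsBlowup π I ∧ Scheme.IsRegular N₀)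
    fun U X f g V η h₁ h₂ h₃ h₄ h₅ h₆ h₇ h₈ h₉ h₁₀ h₁₁ h₁₂ h₁₃ =>
      hS k U X f g V η h₁ h₂ h₃ h₄ h₅ h₆ h₇ h₈ h₉ h₁₀ h₁₁ h₁₂ h₁₃

/-- **SANDᵇ(p) ⇒ SANDᴸ(p), with no compactification and no gluing**: resolve the
sandwiched-singularity open `O` by one blowing up (the atom), extend the blowing up to `M` along
the push-forward ideal (stub B0), and read regularity over `O` off the cartesian square.
[cite: Piltant2013, Prop. 5.1 (proof, Step 2)] -/
theorem sandwichedLocusResolution_of_sandwichedBlowup {p : ℕ}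
    (hS : SandwichedBlowupResolution.{u} p) : SandwichedLocusResolution.{u} p := by
  intro k _ _ U M f g O V η hf₁ hf₂ hf₃ hU hUreg hg₁ hg₂ hg₃ hM hη hbir hcompat hVO hout
  haveI := hf₁; haveI := hf₂; haveI := hf₃; haveI := hU; haveI := hg₁; haveI := hg₂
  haveI := hg₃; haveI := hM; haveI := hη
  haveI : IsLocallyNoetherian M := LocallyOfFiniteType.isLocallyNoetherian g
  by_cases hO : (O : Set M).Nonempty
  swap
  · -- `O = ∅`: the identity does it
    exact ⟨M, 𝟙 M, inferInstance, inferInstance, isBirational_of_isIso (𝟙 M),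
      fun n hn => absurd ⟨_, hn⟩ hO⟩
  haveI : Nonempty (O : Scheme.{u}) := by
    obtain ⟨x, hx⟩ := hO
    exact ⟨⟨x, hx⟩⟩
  obtain ⟨I, N₀, π, hI, hπ, hreg⟩ :=
    exists_isBlowup_opens_of_sandwichedBlowup hS f g hUreg O V η hbir hcompat hVO hout
  exact exists_regular_over_of_isBlowup_opens O hI hπ hreg

/-- **Registered stub B1 of line `sandwiched-gluing` (v3 cut)** (crux
stmt-ResolutionOfSingularities-0642, universe `0`): SANDᵇ(p) ⇒ SANDᴸ(p).
[cite: Piltant2013, Prop. 5.1 (proof, Step 2)] -/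
theorem stub_sandwichedLocus_of_sandwichedBlowup :
    ∀ p : ℕ, SandwichedBlowupResolution.{0} p → SandwichedLocusResolution.{0} p :=
  fun _ hS => sandwichedLocusResolution_of_sandwichedBlowup hS

/-- Hence **SANDᵇ(p) ⇒ SANDʷ(p)** (the absolute forms: a variety with sandwiched singular locus
which is desingularised by a blowing up has, in particular, a resolution). [folklore] -/
theorem sandwichedSingularitiesResolution_of_sandwichedBlowup {p : ℕ}
    (hS : SandwichedBlowupResolution.{u} p) : SandwichedSingularitiesResolution.{u} p :=
  sandwichedSingularitiesResolution_of_sandwichedLocus (sandwichedLocusResolution_of_sandwichedBlowup hS)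

/-! ## The dimension slice of the bridge -/

/-- SANDᵇ(p) in dimension `> d` desingularises, by a blowing up, a non-empty sandwiched-singularity
open `O` of a variety `M` of dimension `> d`: `dim O = dim M` (Görtz–Wedhorn I, Thm. 5.22 (3),
`topologicalKrullDim_opens_eq`). [cite: GortzWedhorn2020, Thm. 5.22 (3)] -/
theorem exists_isBlowup_opens_of_sandwichedBlowupDimGt {p d : ℕ}
    (hS : SandwichedBlowupResolutionDimGt.{u} p d)
    {k : Type u} [Field k] [CharP k p] {U M : Scheme.{u}} (f : U ⟶ Spec (.of k))
    (g : M ⟶ Spec (.of k)) [IsSeparated f] [LocallyOfFiniteType f] [QuasiCompact f]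
    [IsIntegral U] (hU : Scheme.IsRegular U) [IsSeparated g] [LocallyOfFiniteType g]
    [QuasiCompact g] [IsIntegral M] (O V : M.Opens) (η : (V : Scheme.{u}) ⟶ U) [IsProper η]
    (hbir : IsBirational η) (hcompat : η ≫ f = V.ι ≫ g) (hVO : V ≤ O)
    (hout : ∀ x : M, x ∈ O → x ∉ V → IsRegularLocalRing (M.presheaf.stalk x))
    (hO : (O : Set M).Nonempty) (hdim : (d : WithBot ℕ∞) < topologicalKrullDim M) :
    ∃ (I : (O : Scheme.{u}).IdealSheafData) (N₀ : Scheme.{u}) (π : N₀ ⟶ (O : Scheme.{u})),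
      I ≠ ⊥ ∧ IsBlowup π I ∧ Scheme.IsRegular N₀ := by
  haveI : Nonempty (O : Scheme.{u}) := hO.to_subtype
  have hdimO : (d : WithBot ℕ∞) < topologicalKrullDim (O : Scheme.{u}) := by
    rw [topologicalKrullDim_opens_eq g O hO]
    exact hdim
  exact sandwichedDatum_opens f g hU O V η hbir hcompat hVO hout
    (P := fun X => (d : WithBot ℕ∞) < topologicalKrullDim X →
      ∃ (I : X.IdealSheafData) (N₀ : Scheme.{u}) (π : N₀ ⟶ X),
        I ≠ ⊥ ∧ IsBlowup π I ∧ Scheme.IsRegular N₀)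
    (fun U X f g V η h₁ h₂ h₃ h₄ h₅ h₆ h₇ h₈ h₉ h₁₀ h₁₁ h₁₂ h₁₃ h₁₄ =>
      hS k U X f g V η h₁ h₂ h₃ h₄ h₅ h₆ h₇ h₈ h₉ h₁₀ h₁₁ h₁₂ h₁₃ h₁₄) hdimO

/-- **SANDᵇDimGt(p, d) ⇒ SANDᴸDimGt(p, d)**: the bridge slice by slice in the dimension.
[cite: Piltant2013, Prop. 5.1 (proof, Step 2)] -/
theorem sandwichedLocusResolutionDimGt_of_sandwichedBlowupDimGt {p d : ℕ}
    (hS : SandwichedBlowupResolutionDimGt.{u} p d) : SandwichedLocusResolutionDimGt.{u} p d := by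
  intro k _ _ U M f g O V η hf₁ hf₂ hf₃ hU hUreg hg₁ hg₂ hg₃ hM hη hbir hcompat hVO hout hdim
  haveI := hf₁; haveI := hf₂; haveI := hf₃; haveI := hU; haveI := hg₁; haveI := hg₂
  haveI := hg₃; haveI := hM; haveI := hη
  haveI : IsLocallyNoetherian M := LocallyOfFiniteType.isLocallyNoetherian g
  by_cases hO : (O : Set M).Nonempty
  swap
  · exact ⟨M, 𝟙 M, inferInstance, inferInstance, isBirational_of_isIso (𝟙 M),
      fun n hn => absurd ⟨_, hn⟩ hO⟩
  obtain ⟨I, N₀, π, hI, hπ, hreg⟩ :=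
    exists_isBlowup_opens_of_sandwichedBlowupDimGt hS f g hUreg O V η hbir hcompat hVO hout hO hdim
  exact exists_regular_over_of_isBlowup_opens O hI hπ hreg

/-- **Registered stub B5 of line `sandwiched-gluing` (v3 cut)** (crux
stmt-ResolutionOfSingularities-0642, universe `0`): SANDᵇDimGt(p, d) ⇒ SANDᴸDimGt(p, d).
[cite: Piltant2013, Prop. 5.1 (proof, Step 2)] -/
theorem stub_sandwichedLocusDimGt_of_sandwichedBlowupDimGt :
    ∀ p d : ℕ, SandwichedBlowupResolutionDimGt.{0} p d → SandwichedLocusResolutionDimGt.{0} p d :=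
  fun _ _ hS => sandwichedLocusResolutionDimGt_of_sandwichedBlowupDimGt hS

end Summit.ResolutionOfSingularities.ResolutionOfSingularities.Theorems

end
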